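import Summits.CriticalPhenomena.PercolationContinuityZ3.Theorems.PercNearOneGluingNoHeavyLowerTailSahiCombTriWAndQ311Cols

/-!
# AND with the block `p4c` (perfect4 with an AND-doubled centre), part 2: the block, its columns, sorted profiles, order / link facts

Support file of the one-cut programme (crux `NoHeavyLowerTail`, stmt-CriticalPhenomena-4575; unit `prim-lf-1` gen 58, memo
`FROM-prim-lf-1-gen58-Q311-LEAN-AND-PROFILE-NOGO.md`).  `p4c = x₀x₄(x₁ ∨ x₂ ∨ x₃) ∨ x₁x₂x₃ ⊆ 2^{Fin 5}` is perfect4 `c(x₁∨x₂∨x₃) ∨ x₁x₂x₃`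
with the centre substituted by an AND, `c := x₀x₄` — an instance of the SUBSTITUTION CONJECTURE H (gen 51) and, by the gen-58 census, one of
the four genuinely five-variable intersecting Kleitman-shell blocks outside the landed claw families.  Points: `⊤`, `g = {1,2,3}`,
`z₀ = ⊤ − 4`, `z₄ = ⊤ − 0` (the two lifts of `g`), `p_a = {0,4,a}` and `T^a = ⊤ − a` (`a = 1,2,3`).
This file (infrastructure, no certificate yet): the block (up-set, antipode-free, row sum), the named columns via the generic fibre columns
`bcol` of `…AndQ311Cols`, the sorted profiles of the `p`- and `T`-triples and of the pair `(z₀, z₄)`, their bounds / sortedness / ORDER facts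
(`g ≤ z₋`, `z₊ ≤ u`, `p₍₂₎ ≤ T₍₁₎`, `p₍₃₎ ≤ T₍₂₎`, `T₍₃₎ ≤ u` — the exact characterisation of the 383 realizable profiles), monotonicity in the
point, and the LINK facts between the statistics at two points covering `⊤` (rank matching `p_a ~ T^a`, `p ~ g`, `p ~ z`, `T ~ T`, `T ~ g`,
`T ~ z`, `z₀ ~ z₄`, `⊤ ~` everything).
HONEST LABEL: elementary bookkeeping lemmas (indicator arithmetic, `omega` case analyses); standard axioms. [this work]
-/

namespace Summit.CriticalPhenomena.PercolationContinuityZ3.Theorems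

namespace FiveUpSet

open Finset

variable {γ₁ : Type} [DecidableEq γ₁] [Fintype γ₁]

/-! ### The block -/

/-- The embedding of the three petal indices `Fin 3` into `Fin 5` (`i ↦ i + 1`). [this work] -/
def pId (i : Fin 3) : Fin 5 := ⟨i.val + 1, by omega⟩

/-- `p4c = x₀x₄(x₁ ∨ x₂ ∨ x₃) ∨ x₁x₂x₃` as a family of subsets of `Fin 5`: `⊤`, `⊤ − a` (`a = 1,2,3`), `z₀ = ⊤ − 4`, `z₄ = ⊤ − 0`, `{0,4,a}`,
`g = {1,2,3}`. [this work] -/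
def p4c : Finset (Finset (Fin 5)) :=
  {univ, univ.erase 1, univ.erase 2, univ.erase 3, univ.erase 4, univ.erase 0, {0, 4, 1}, {0, 4, 2}, {0, 4, 3}, {1, 2, 3}}

/-- `p4c` is an up-set. [this work] -/
theorem isUpperSet_p4c : IsUpperSet (p4c : Set (Finset (Fin 5))) := by
  intro y y' h hy
  have key : ∀ s ∈ p4c, ∀ t : Finset (Fin 5), s ⊆ t → t ∈ p4c := by decide
  exact key y hy y' h

/-- `p4c` is antipode-free. [this work] -/
theorem disjoint_p4c_refl : Disjoint p4c (refl p4c) := by decide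

/-- Summing over `p4c`: top, `g`, `z₀`, `z₄`, the three co-atoms `⊤ − (i+1)` and the three triples `{0,4,i+1}`. [this work] -/
theorem sum_p4c (f : Finset (Fin 5) → ℤ) :
    ∑ y ∈ p4c, f y = f univ + f {1, 2, 3} + f (univ.erase 4) + f (univ.erase 0)
      + ∑ i : Fin 3, f (univ.erase (pId i)) + ∑ i : Fin 3, f {0, 4, pId i} := by
  rw [p4c, Fin.sum_univ_three, Fin.sum_univ_three, sum_insert (by decide), sum_insert (by decide), sum_insert (by decide),
    sum_insert (by decide), sum_insert (by decide), sum_insert (by decide), sum_insert (by decide), sum_insert (by decide),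
    sum_insert (by decide), sum_singleton]
  show f univ + (f (univ.erase 1) + (f (univ.erase 2) + (f (univ.erase 3) + (f (univ.erase 4) + (f (univ.erase 0)
      + (f {0, 4, 1} + (f {0, 4, 2} + (f {0, 4, 3} + f {1, 2, 3})))))))) =
    f univ + f {1, 2, 3} + f (univ.erase 4) + f (univ.erase 0)
      + (f (univ.erase (1 : Fin 5)) + f (univ.erase (2 : Fin 5)) + f (univ.erase (3 : Fin 5)))
      + (f {0, 4, (1 : Fin 5)} + f {0, 4, (2 : Fin 5)} + f {0, 4, (3 : Fin 5)})
  ring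

/-! ### The named columns of `p4c` and the sorted profiles (`qU`, `qB = z₄` are reused from `…AndQ311Cols`) -/

/-- Petal-triple column `g = δ_A(x ⊔ {1,2,3})`. [this work] -/
def cG5 (A : Finset (Finset (γ₁ ⊕ Fin 5))) (x : Finset γ₁) : ℤ := bcol A {1, 2, 3} x

/-- Lift `z₀ = δ_A(x ⊔ (⊤ − 4))`. [this work] -/
def cZ0 (A : Finset (Finset (γ₁ ⊕ Fin 5))) (x : Finset γ₁) : ℤ := bcol A (univ.erase 4) x

/-- Pair column `p_a = δ_A(x ⊔ {0,4,a+1})`. [this work] -/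
def cP5 (A : Finset (Finset (γ₁ ⊕ Fin 5))) (i : Fin 3) (x : Finset γ₁) : ℤ := bcol A {0, 4, pId i} x

/-- Co-atom column `T^a = δ_A(x ⊔ (⊤ − (a+1)))`. [this work] -/
def cT5 (A : Finset (Finset (γ₁ ⊕ Fin 5))) (i : Fin 3) (x : Finset γ₁) : ℤ := bcol A (univ.erase (pId i)) x

/-- Sorted `p`-profile: minimum. [this work] -/
def cpMin (A : Finset (Finset (γ₁ ⊕ Fin 5))) (x : Finset γ₁) : ℤ := min (min (cP5 A 0 x) (cP5 A 1 x)) (cP5 A 2 x)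

/-- Sorted `p`-profile: maximum. [this work] -/
def cpMax (A : Finset (Finset (γ₁ ⊕ Fin 5))) (x : Finset γ₁) : ℤ := max (max (cP5 A 0 x) (cP5 A 1 x)) (cP5 A 2 x)

/-- Sorted `p`-profile: median. [this work] -/
def cpMed (A : Finset (Finset (γ₁ ⊕ Fin 5))) (x : Finset γ₁) : ℤ := cP5 A 0 x + cP5 A 1 x + cP5 A 2 x - cpMin A x - cpMax A x

/-- Sorted `T`-profile: minimum. [this work] -/
def ctMin (A : Finset (Finset (γ₁ ⊕ Fin 5))) (x : Finset γ₁) : ℤ := min (min (cT5 A 0 x) (cT5 A 1 x)) (cT5 A 2 x)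

/-- Sorted `T`-profile: maximum. [this work] -/
def ctMax (A : Finset (Finset (γ₁ ⊕ Fin 5))) (x : Finset γ₁) : ℤ := max (max (cT5 A 0 x) (cT5 A 1 x)) (cT5 A 2 x)

/-- Sorted `T`-profile: median. [this work] -/
def ctMed (A : Finset (Finset (γ₁ ⊕ Fin 5))) (x : Finset γ₁) : ℤ := cT5 A 0 x + cT5 A 1 x + cT5 A 2 x - ctMin A x - ctMax A x

/-- Sorted pair `(z₀, z₄)`: minimum `z₋`. [this work] -/
def zLo (A : Finset (Finset (γ₁ ⊕ Fin 5))) (x : Finset γ₁) : ℤ := min (cZ0 A x) (qB A x)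

/-- Sorted pair `(z₀, z₄)`: maximum `z₊`. [this work] -/
def zHi (A : Finset (Finset (γ₁ ⊕ Fin 5))) (x : Finset γ₁) : ℤ := max (cZ0 A x) (qB A x)

section facts
variable {A : Finset (Finset (γ₁ ⊕ Fin 5))} (hA : IsUpperSet (A : Set (Finset (γ₁ ⊕ Fin 5))))

/-- Bounds of the named columns. [this work] -/
theorem p4c_cols_bounds (x : Finset γ₁) :
    (-1 ≤ qU A x ∧ qU A x ≤ 1) ∧ (-1 ≤ cG5 A x ∧ cG5 A x ≤ 1) ∧ (-1 ≤ cZ0 A x ∧ cZ0 A x ≤ 1) ∧ (-1 ≤ qB A x ∧ qB A x ≤ 1)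
      ∧ (∀ i : Fin 3, (-1 ≤ cP5 A i x ∧ cP5 A i x ≤ 1) ∧ (-1 ≤ cT5 A i x ∧ cT5 A i x ≤ 1)) :=
  ⟨bcol_bounds A _ x, bcol_bounds A _ x, bcol_bounds A _ x, bcol_bounds A _ x, fun _ => ⟨bcol_bounds A _ x, bcol_bounds A _ x⟩⟩

/-- Bounds of the eight profile statistics. [this work] -/
theorem p4c_stats_bounds (x : Finset γ₁) :
    (-1 ≤ cpMin A x ∧ cpMin A x ≤ 1) ∧ (-1 ≤ cpMed A x ∧ cpMed A x ≤ 1) ∧ (-1 ≤ cpMax A x ∧ cpMax A x ≤ 1)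
      ∧ (-1 ≤ ctMin A x ∧ ctMin A x ≤ 1) ∧ (-1 ≤ ctMed A x ∧ ctMed A x ≤ 1) ∧ (-1 ≤ ctMax A x ∧ ctMax A x ≤ 1)
      ∧ (-1 ≤ zLo A x ∧ zLo A x ≤ 1) ∧ (-1 ≤ zHi A x ∧ zHi A x ≤ 1) := by
  obtain ⟨_, _, hz, hb, hi⟩ := p4c_cols_bounds (A := A) x
  have h0 := hi 0; have h1 := hi 1; have h2 := hi 2
  unfold cpMed cpMin cpMax ctMed ctMin ctMax zLo zHi
  refine ⟨⟨?_, ?_⟩, ⟨?_, ?_⟩, ⟨?_, ?_⟩, ⟨?_, ?_⟩, ⟨?_, ?_⟩, ⟨?_, ?_⟩, ⟨?_, ?_⟩, ⟨?_, ?_⟩⟩ <;> omega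

/-- Sortedness: `p₍₁₎ ≤ p₍₂₎ ≤ p₍₃₎`, `T₍₁₎ ≤ T₍₂₎ ≤ T₍₃₎`, `z₋ ≤ z₊`. [this work] -/
theorem p4c_stats_sorted (x : Finset γ₁) :
    cpMin A x ≤ cpMed A x ∧ cpMed A x ≤ cpMax A x ∧ ctMin A x ≤ ctMed A x ∧ ctMed A x ≤ ctMax A x ∧ zLo A x ≤ zHi A x := by
  unfold cpMed cpMin cpMax ctMed ctMin ctMax zLo zHi
  refine ⟨?_, ?_, ?_, ?_, ?_⟩ <;> omega

include hA

/-- Order facts: `g ≤ z₋`, `z₊ ≤ u`, `p₍₂₎ ≤ T₍₁₎`, `p₍₃₎ ≤ T₍₂₎`, `T₍₃₎ ≤ u`. [this work] -/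
theorem p4c_stats_order (x : Finset γ₁) :
    cG5 A x ≤ zLo A x ∧ zHi A x ≤ qU A x ∧ cpMed A x ≤ ctMin A x ∧ cpMax A x ≤ ctMed A x ∧ ctMax A x ≤ qU A x := by
  have hgz : cG5 A x ≤ cZ0 A x := bcol_mono_fibre hA (by decide) x
  have hgb : cG5 A x ≤ qB A x := bcol_mono_fibre hA (by decide) x
  have hzu : cZ0 A x ≤ qU A x := bcol_mono_fibre hA (subset_univ _) x
  have hbu : qB A x ≤ qU A x := bcol_mono_fibre hA (subset_univ _) x
  have ht : ∀ i : Fin 3, cT5 A i x ≤ qU A x := fun i => bcol_mono_fibre hA (subset_univ _) x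
  have hpt : ∀ i j : Fin 3, i ≠ j → cP5 A i x ≤ cT5 A j x := by
    intro i j hij
    have hs : ({0, 4, pId i} : Finset (Fin 5)) ⊆ univ.erase (pId j) := by
      fin_cases i <;> fin_cases j <;> first | exact absurd rfl hij | decide
    exact bcol_mono_fibre hA hs x
  have t0 := ht 0; have t1 := ht 1; have t2 := ht 2
  have o01 := hpt 0 1 (by decide); have o02 := hpt 0 2 (by decide); have o10 := hpt 1 0 (by decide)
  have o12 := hpt 1 2 (by decide); have o20 := hpt 2 0 (by decide); have o21 := hpt 2 1 (by decide)
  refine ⟨?_, ?_, ?_, ?_, ?_⟩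
  · unfold zLo; omega
  · unfold zHi; omega
  · unfold cpMed cpMin cpMax ctMin; omega
  · unfold cpMax ctMed ctMin ctMax; omega
  · unfold ctMax; omega

/-- Monotonicity of the columns and statistics in the point. [this work] -/
theorem p4c_stats_mono {x x' : Finset γ₁} (h : x ⊆ x') :
    qU A x ≤ qU A x' ∧ cG5 A x ≤ cG5 A x' ∧ zLo A x ≤ zLo A x' ∧ zHi A x ≤ zHi A x'
      ∧ cpMin A x ≤ cpMin A x' ∧ cpMed A x ≤ cpMed A x' ∧ cpMax A x ≤ cpMax A x'
      ∧ ctMin A x ≤ ctMin A x' ∧ ctMed A x ≤ ctMed A x' ∧ ctMax A x ≤ ctMax A x' := by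
  have hp : ∀ i : Fin 3, cP5 A i x ≤ cP5 A i x' := fun i => bcol_mono hA _ h
  have ht : ∀ i : Fin 3, cT5 A i x ≤ cT5 A i x' := fun i => bcol_mono hA _ h
  have hz : cZ0 A x ≤ cZ0 A x' := bcol_mono hA _ h
  have hb : qB A x ≤ qB A x' := bcol_mono hA _ h
  have p0 := hp 0; have p1 := hp 1; have p2 := hp 2; have t0 := ht 0; have t1 := ht 1; have t2 := ht 2
  refine ⟨bcol_mono hA _ h, bcol_mono hA _ h, ?_, ?_, ?_, ?_, ?_, ?_, ?_, ?_⟩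
  · unfold zLo; omega
  · unfold zHi; omega
  · unfold cpMin; omega
  · unfold cpMed cpMin cpMax; simp only [min_def, max_def]; split_ifs <;> omega
  · unfold cpMax; omega
  · unfold ctMin; omega
  · unfold ctMed ctMin ctMax; simp only [min_def, max_def]; split_ifs <;> omega
  · unfold ctMax; omega

/-- **Link facts between the statistics** at two points covering `⊤`: rank matching `p_a ~ T^a` (`p₍ₖ₎ + T'₍₄₋ₖ₎ ≥ 0`), `p ~ g`, `p ~ z`,
`T₍₁₎ ~ T₍₂₎`, `T ~ g`, `T ~ z`, `z₀ ~ z₄`, and the top with everything. [this work] -/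
theorem p4c_links {x x' : Finset γ₁} (h : x ∪ x' = univ) :
    (0 ≤ cpMin A x + ctMax A x' ∧ 0 ≤ cpMed A x + ctMed A x' ∧ 0 ≤ cpMax A x + ctMin A x')
      ∧ (0 ≤ cpMin A x + cG5 A x' ∧ 0 ≤ cG5 A x + cpMin A x' ∧ 0 ≤ cpMin A x + zLo A x' ∧ 0 ≤ zLo A x + cpMin A x')
      ∧ (0 ≤ ctMin A x + ctMed A x' ∧ 0 ≤ ctMin A x + cG5 A x' ∧ 0 ≤ cG5 A x + ctMin A x' ∧ 0 ≤ ctMin A x + zLo A x'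
          ∧ 0 ≤ zLo A x + ctMin A x')
      ∧ (0 ≤ zLo A x + zHi A x' ∧ 0 ≤ qU A x + qU A x' ∧ 0 ≤ qU A x + cG5 A x' ∧ 0 ≤ qU A x + zLo A x' ∧ 0 ≤ qU A x + cpMin A x'
          ∧ 0 ≤ qU A x + ctMin A x') := by
  have hPT : ∀ i : Fin 3, 0 ≤ cP5 A i x + cT5 A i x' := by
    intro i
    have hy : ({0, 4, pId i} : Finset (Fin 5)) ∪ univ.erase (pId i) = univ := by fin_cases i <;> decide
    exact bcol_pair hA hy h
  have hPG : ∀ i : Fin 3, 0 ≤ cP5 A i x + cG5 A x' := fun i => bcol_pair hA (by fin_cases i <;> decide) h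
  have hGP : ∀ i : Fin 3, 0 ≤ cG5 A x + cP5 A i x' := fun i => bcol_pair hA (by fin_cases i <;> decide) h
  have hPZ : ∀ i : Fin 3, 0 ≤ cP5 A i x + cZ0 A x' := fun i => bcol_pair hA (by fin_cases i <;> decide) h
  have hPB : ∀ i : Fin 3, 0 ≤ cP5 A i x + qB A x' := fun i => bcol_pair hA (by fin_cases i <;> decide) h
  have hZP : ∀ i : Fin 3, 0 ≤ cZ0 A x + cP5 A i x' := fun i => bcol_pair hA (by fin_cases i <;> decide) h
  have hBP : ∀ i : Fin 3, 0 ≤ qB A x + cP5 A i x' := fun i => bcol_pair hA (by fin_cases i <;> decide) h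
  have hTT : ∀ i j : Fin 3, i ≠ j → 0 ≤ cT5 A i x + cT5 A j x' := by
    intro i j hij
    have hy : univ.erase (pId i) ∪ univ.erase (pId j) = (univ : Finset (Fin 5)) := by
      fin_cases i <;> fin_cases j <;> first | exact absurd rfl hij | decide
    exact bcol_pair hA hy h
  have hTG : ∀ i : Fin 3, 0 ≤ cT5 A i x + cG5 A x' := fun i => bcol_pair hA (by fin_cases i <;> decide) h
  have hGT : ∀ i : Fin 3, 0 ≤ cG5 A x + cT5 A i x' := fun i => bcol_pair hA (by fin_cases i <;> decide) h
  have hTZ : ∀ i : Fin 3, 0 ≤ cT5 A i x + cZ0 A x' := fun i => bcol_pair hA (by fin_cases i <;> decide) h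
  have hTB : ∀ i : Fin 3, 0 ≤ cT5 A i x + qB A x' := fun i => bcol_pair hA (by fin_cases i <;> decide) h
  have hZT : ∀ i : Fin 3, 0 ≤ cZ0 A x + cT5 A i x' := fun i => bcol_pair hA (by fin_cases i <;> decide) h
  have hBT : ∀ i : Fin 3, 0 ≤ qB A x + cT5 A i x' := fun i => bcol_pair hA (by fin_cases i <;> decide) h
  have hZB : 0 ≤ cZ0 A x + qB A x' := bcol_pair hA (by decide) h
  have hBZ : 0 ≤ qB A x + cZ0 A x' := bcol_pair hA (by decide) h
  have hUU : 0 ≤ qU A x + qU A x' := bcol_pair hA (by simp) h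
  have hUG : 0 ≤ qU A x + cG5 A x' := bcol_pair hA (by simp) h
  have hUZ : 0 ≤ qU A x + cZ0 A x' := bcol_pair hA (by simp) h
  have hUB : 0 ≤ qU A x + qB A x' := bcol_pair hA (by simp) h
  have hUP : ∀ i : Fin 3, 0 ≤ qU A x + cP5 A i x' := fun i => bcol_pair hA (by simp) h
  have hUT : ∀ i : Fin 3, 0 ≤ qU A x + cT5 A i x' := fun i => bcol_pair hA (by simp) h
  have a0 := hPT 0; have a1 := hPT 1; have a2 := hPT 2; have b0 := hPG 0; have b1 := hPG 1; have b2 := hPG 2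
  have c0 := hGP 0; have c1 := hGP 1; have c2 := hGP 2; have d0 := hPZ 0; have d1 := hPZ 1; have d2 := hPZ 2
  have e0 := hPB 0; have e1 := hPB 1; have e2 := hPB 2; have f0 := hZP 0; have f1 := hZP 1; have f2 := hZP 2
  have g0 := hBP 0; have g1 := hBP 1; have g2 := hBP 2
  have t01 := hTT 0 1 (by decide); have t02 := hTT 0 2 (by decide); have t10 := hTT 1 0 (by decide)
  have t12 := hTT 1 2 (by decide); have t20 := hTT 2 0 (by decide); have t21 := hTT 2 1 (by decide)
  have i0 := hTG 0; have i1 := hTG 1; have i2 := hTG 2; have j0 := hGT 0; have j1 := hGT 1; have j2 := hGT 2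
  have k0 := hTZ 0; have k1 := hTZ 1; have k2 := hTZ 2; have l0 := hTB 0; have l1 := hTB 1; have l2 := hTB 2
  have m0 := hZT 0; have m1 := hZT 1; have m2 := hZT 2; have n0 := hBT 0; have n1 := hBT 1; have n2 := hBT 2
  have u0 := hUP 0; have u1 := hUP 1; have u2 := hUP 2; have v0 := hUT 0; have v1 := hUT 1; have v2 := hUT 2
  refine ⟨⟨?_, ?_, ?_⟩, ⟨?_, ?_, ?_, ?_⟩, ⟨?_, ?_, ?_, ?_, ?_⟩, ⟨?_, hUU, hUG, ?_, ?_, ?_⟩⟩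
  · unfold cpMin ctMax; omega
  · unfold cpMed cpMin cpMax ctMed ctMin ctMax; simp only [min_def, max_def]; split_ifs <;> omega
  · unfold cpMax ctMin; omega
  · unfold cpMin; omega
  · unfold cpMin; omega
  · unfold cpMin zLo; omega
  · unfold zLo cpMin; omega
  · unfold ctMed ctMin ctMax; simp only [min_def, max_def]; split_ifs <;> omega
  · unfold ctMin; omega
  · unfold ctMin; omega
  · unfold ctMin zLo; omega
  · unfold zLo ctMin; omega
  · unfold zLo zHi; omega
  · unfold zLo; omega
  · unfold cpMin; omega
  · unfold ctMin; omega

end facts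

end FiveUpSet

end Summit.CriticalPhenomena.PercolationContinuityZ3.Theorems
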